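import Literature.NumberTheory.Transcendental.CurvePeriodsEllipticSegmentsProofs
import Mathlib.Analysis.Calculus.Deriv.Inverse
import HarnessLib

/-!
# Periods of curve type on an elliptic curve, II: the doubling descent `[a, b] ∼ ½ [2a, 2b]`

Companion of `CurvePeriodsEllipticSegmentsProofs.lean` (segment symbols `(E_L, ω, φ∘[a,b])` on
the Weierstrass curve `E_L : y² = x³ − (g₂/4)x − g₃/4` of a period pair `L`, `φ = (℘, ℘′/2)`).
Here we prove the **doubling descent**: if the closed segment `[a, b]` avoids `½Λ` (so that
`[2a, 2b]` avoids `Λ` and `℘′ ≠ 0` along `[a, b]`), then modulo the elementary relations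

  `(E_L, θ₀, φ∘[2a, 2b]) ∼ 2 · (E_L, θ₀, φ∘[a, b])`,
  `(E_L, θ₁, φ∘[2a, 2b]) ∼ 2 · (E_L, θ₁, φ∘[a, b]) + c · 𝟙`  (`c ∈ ℚ̄` explicit),

`θ₀ = dx/y`, `θ₁ = x dx/y` (`Ell.span_descent_theta0`, `Ell.span_descent_theta1`). This is
functoriality (R4) of Huber–Wüstholz's Theorem 13.3 (2) along the multiplication-by-`2` map,
which is a morphism of smooth affine curves `[2] : E_L ∖ E_L[2] → E_L`; in the embedded
rendering of `CurvePeriods.lean` the source is the smooth affine curve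

  `Z₂ = {(x, y, w) ∈ 𝔸³ | y² = x³ + Ax + B, w y = 1}`  (`Ell.curve2`),

with the two polynomial maps `ι = (x, y)` and `dbl = (m² − 2x, m(3x − m²) − y)`,
`m = (3x² + A) w / 2` (the tangent-chord doubling, Silverman AEC III.2.3 (d)), and the relations
used are: (R4) along `ι` and along `dbl` for the lifted path `ψ∘[a,b]`, `ψ = (℘, ℘′/2, 2/℘′)`;
(R1), (R2) for the identities of forms on `Z₂`

  `dbl^* θ₀ = 2 ι^* θ₀ + ν₀`,  `dbl^* θ₁ = 2 ι^* θ₁ + d(−(3x² + A) w) + ν₁`,  `ν₀, ν₁ = 0` on `Z₂`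

(`[2]^* dz = 2 dz`; `[2]^*(℘ dz) = 2℘ dz − d(℘″/℘′)/… ` i.e. `ζ(2z) = 2ζ(z) + ℘″(z)/(2℘′(z))`,
book §18.1 and Armitage–Eberlein §7.4.2), proved ANALYTICALLY: `Z₂` is parametrised by `ψ`
(`Ell.exists_psi_eq`), its tangent line at `ψ(z)` is spanned by `ψ′(z)` (`tangent_parallel`), and
along `ψ` the pairings are computed from `φ^*θ₀ = 2dz`, `φ^*θ₁ = 2℘dz` at `z` and `2z` and the
duplication formulas of the tree (`PeriodPair.weierstrassP_two_mul_holds`,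
`PeriodPair.derivWeierstrassP_two_mul_of_notMem`); and (R3) for the exact term.

## References

* A. Huber, G. Wüstholz, *Transcendence and Linear Relations of 1-Periods*, Cambridge Tracts in
  Mathematics 227, CUP 2022 [HuberWustholz2022]: Thm. 13.3 (2) (p. 121), §13.1 (B) (p. 120,
  functoriality), §18.1 (p. 160).
* J. H. Silverman, *The Arithmetic of Elliptic Curves*, GTM 106, III.2.3 (duplication formula).
* J. V. Armitage, W. F. Eberlein, *Elliptic Functions*, CUP 2006, §7.4.2 (`℘(2u)`, `ζ(2u)`).
-/

noncomputable section

open scoped BigOperators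
open scoped PeriodPair
open scoped Topology
open MvPolynomial Set Complex Filter

namespace Literature.NumberTheory.Transcendental

namespace CurvePeriods

set_option quotPrecheck false in
/-- Membership in the `ℚ̄`-span of the elementary relations, in the format of the conclusion of
`HuberWustholzCurvePeriods`. -/
local notation "InSpan" c:max => ∃ (k : ℕ) (ρ : Fin k → (PeriodSymbol →₀ ℂ)) (a : Fin k → ℂ),
  (∀ l, IsElementaryRelation (ρ l)) ∧ (∀ l, IsAlgebraic ℚ (a l)) ∧ c = ∑ l, a l • ρ l

namespace Ell

variable (L : PeriodPair)

/-! ### Pairing a pulled-back form with a vector -/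

/-- `(f^*ω′)(p) · v = ω′(f(p)) · (Df(p) v)` (the chain rule, algebraically). [folklore] -/
theorem formPullback_pair {n n' : ℕ} (f : Fin n' → MvPolynomial (Fin n) ℂ)
    (ω' : Fin n' → MvPolynomial (Fin n') ℂ) (p v : Fin n → ℂ) :
    ∑ i, eval p (formPullback f ω' i) * v i =
      ∑ j, eval (fun j => eval p (f j)) (ω' j) * ∑ i, eval p (pderiv i (f j)) * v i := by
  simp only [formPullback, map_sum, map_mul, eval_bind₁_eq, Finset.sum_mul, Finset.mul_sum]
  rw [Finset.sum_comm]
  refine Finset.sum_congr rfl fun i _ => Finset.sum_congr rfl fun j _ => ?_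
  ring

/-! ### The localised curve `Z₂ = {y² = f(x), w y = 1} ⊂ 𝔸³` (`E_L` minus its `2`-torsion) -/

/-- The cubic `f = x³ + Ax + B` in the variables `x, y, w`. [folklore] -/
def fPoly3 : MvPolynomial (Fin 3) ℂ := X 0 ^ 3 + C (A L) * X 0 + C (B L)

/-- **The affine curve `Z₂ = {(x, y, w) | y² = x³ + Ax + B, w y = 1}`**, isomorphic (by
`(x, y, w) ↦ (x, y)`) to `E_L` minus its three affine `2`-torsion points `y = 0`; the domain of
the doubling map as a polynomial map. [folklore] -/
abbrev curve2 : CurveData := ⟨3, 2, ![X 1 ^ 2 - fPoly3 L, X 2 * X 1 - 1]⟩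

/-- `f(p) = p₀³ + A p₀ + B`. [folklore] -/
theorem eval_fPoly3 (p : Fin 3 → ℂ) : eval p (fPoly3 L) = p 0 ^ 3 + A L * p 0 + B L := by
  simp [fPoly3]

/-- `p ∈ Z₂ ↔ p₁² = f(p₀) ∧ p₂ p₁ = 1`. [folklore] -/
theorem mem_points_curve2_iff (p : Fin 3 → ℂ) :
    p ∈ (curve2 L).points ↔ p 1 ^ 2 = p 0 ^ 3 + A L * p 0 + B L ∧ p 2 * p 1 = 1 := by
  rw [CurveData.mem_points]
  rw [show (∀ j : Fin (curve2 L).m, eval p ((curve2 L).F j) = 0) ↔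
      eval p ((curve2 L).F 0) = 0 ∧ eval p ((curve2 L).F 1) = 0 from Fin.forall_fin_two]
  simp [eval_fPoly3, sub_eq_zero]

/-- `∂f/∂x = 3x² + A`, `∂f/∂y = ∂f/∂w = 0`. [folklore] -/
theorem pderiv_fPoly3 (i : Fin 3) :
    pderiv i (fPoly3 L) = if i = 0 then 3 * X 0 ^ 2 + C (A L) else 0 := by
  fin_cases i
  · simp only [fPoly3, map_add, Derivation.leibniz_pow, pderiv_C]
    simp
  · simp [fPoly3, Derivation.leibniz_pow]
  · simp [fPoly3, Derivation.leibniz_pow]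

/-- The gradient of `y² − f`: `(−(3x² + A), 2y, 0)`. [folklore] -/
theorem gradient_curve2_zero (p : Fin 3 → ℂ) :
    (curve2 L).gradient 0 p = ![-(3 * p 0 ^ 2 + A L), 2 * p 1, 0] := by
  funext k
  simp only [CurveData.gradient, Matrix.cons_val_zero, map_sub, Derivation.leibniz_pow,
    pderiv_fPoly3]
  fin_cases k <;> simp

/-- The gradient of `w y − 1`: `(0, w, y)`. [folklore] -/
theorem gradient_curve2_one (p : Fin 3 → ℂ) :
    (curve2 L).gradient 1 p = ![0, p 2, p 1] := by
  funext k
  simp only [CurveData.gradient, Matrix.cons_val_one]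
  fin_cases k <;> simp

/-- The tangent line of `Z₂` at `p`: `−(3p₀² + A) v₀ + 2p₁ v₁ = 0` and `p₂ v₁ + p₁ v₂ = 0`.
[folklore] -/
theorem mem_tangentSpace_curve2_iff (p v : Fin 3 → ℂ) :
    v ∈ (curve2 L).tangentSpace p ↔
      -(3 * p 0 ^ 2 + A L) * v 0 + 2 * p 1 * v 1 = 0 ∧ p 2 * v 1 + p 1 * v 2 = 0 := by
  simp only [CurveData.tangentSpace, mem_setOf_eq]
  rw [show (∀ j : Fin (curve2 L).m, ∑ i, (curve2 L).gradient j p i * v i = 0) ↔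
      (∑ i, (curve2 L).gradient 0 p i * v i = 0) ∧ (∑ i, (curve2 L).gradient 1 p i * v i = 0)
      from Fin.forall_fin_two, gradient_curve2_zero, gradient_curve2_one]
  simp [Fin.sum_univ_three]

/-! ### The parametrisation `ψ(z) = (℘(z), ℘′(z)/2, 2/℘′(z))` of `Z₂` -/

/-- `ψ(z) = (℘(z), ℘′(z)/2, (℘′(z)/2)⁻¹)`. [folklore] -/
def psi (z : ℂ) : Fin 3 → ℂ := ![℘[L] z, ℘'[L] z / 2, (℘'[L] z / 2)⁻¹]

/-- `ψ′(z) = (℘′, 3℘² − g₂/4, −(3℘² − g₂/4)/(℘′/2)²)`. [folklore] -/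
def psiD (z : ℂ) : Fin 3 → ℂ :=
  ![℘'[L] z, 3 * ℘[L] z ^ 2 - L.g₂ / 4, -(3 * ℘[L] z ^ 2 - L.g₂ / 4) / (℘'[L] z / 2) ^ 2]

/-- [folklore] -/
@[simp] theorem psi_apply_zero (z : ℂ) : psi L z 0 = ℘[L] z := rfl

/-- [folklore] -/
@[simp] theorem psi_apply_one (z : ℂ) : psi L z 1 = ℘'[L] z / 2 := rfl

/-- [folklore] -/
@[simp] theorem psi_apply_two (z : ℂ) : psi L z 2 = (℘'[L] z / 2)⁻¹ := rfl

/-- [folklore] -/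
@[simp] theorem psiD_apply_zero (z : ℂ) : psiD L z 0 = ℘'[L] z := rfl

/-- [folklore] -/
@[simp] theorem psiD_apply_one (z : ℂ) : psiD L z 1 = 3 * ℘[L] z ^ 2 - L.g₂ / 4 := rfl

/-- [folklore] -/
@[simp] theorem psiD_apply_two (z : ℂ) :
    psiD L z 2 = -(3 * ℘[L] z ^ 2 - L.g₂ / 4) / (℘'[L] z / 2) ^ 2 := rfl

/-- `ψ(z) ∈ Z₂` for `z ∉ Λ` with `℘′(z) ≠ 0`. [folklore] -/
theorem psi_mem_points {z : ℂ} (hz : z ∉ L.lattice) (h2 : ℘'[L] z ≠ 0) :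
    psi L z ∈ (curve2 L).points := by
  rw [mem_points_curve2_iff]
  refine ⟨?_, ?_⟩
  · have h := (Weier.mem_points_iff (A L) (B L) (phi L z)).1 (phi_mem_points L hz)
    rw [Weier.eval_fPoly] at h
    simpa using h
  · simp only [psi_apply_two, psi_apply_one]
    exact inv_mul_cancel₀ (div_ne_zero h2 two_ne_zero)

/-- `ψ` has complex derivative `ψ′` off `Λ ∪ {℘′ = 0}`. [folklore] -/
theorem hasDerivAt_psi {z : ℂ} (hz : z ∉ L.lattice) (h2 : ℘'[L] z ≠ 0) :
    ∀ k : Fin 3, HasDerivAt (fun w => psi L w k) (psiD L z k) z := by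
  have h0 := hasDerivAt_phi L hz 0
  have h1 := hasDerivAt_phi L hz 1
  simp only [phi_apply_zero, phiD_apply_zero, phi_apply_one, phiD_apply_one] at h0 h1
  intro k
  fin_cases k
  · exact h0
  · exact h1
  · exact h1.inv (div_ne_zero h2 two_ne_zero)

/-- Along a real shift: `s ↦ ψ(z₀ + s)` has derivative `ψ′(z₀ + t)` at `t`. [folklore] -/
theorem hasDerivAt_psi_shift (z₀ : ℂ) {t : ℝ} (h : z₀ + t ∉ L.lattice) (h2 : ℘'[L] (z₀ + t) ≠ 0)
    (k : Fin 3) : HasDerivAt (fun s : ℝ => psi L (z₀ + s) k) (psiD L (z₀ + t) k) t :=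
  (HasDerivAt.comp_const_add z₀ (t : ℂ) (hasDerivAt_psi L h h2 k)).comp_ofReal

/-- `ψ′(z)` is tangent to `Z₂` at `ψ(z)`. [folklore] -/
theorem psiD_mem_tangentSpace {z : ℂ} (h2 : ℘'[L] z ≠ 0) :
    psiD L z ∈ (curve2 L).tangentSpace (psi L z) := by
  rw [mem_tangentSpace_curve2_iff]
  simp only [psi_apply_zero, psi_apply_one, psi_apply_two, psiD_apply_zero, psiD_apply_one,
    psiD_apply_two, A]
  constructor
  · ring
  · field_simp
    ring

/-- **`ψ` parametrises `Z₂`**: every point of `Z₂` is `ψ(z)` with `z ∉ Λ`, `℘′(z) ≠ 0`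
(`℘` takes every value, `ComplexTorus.exists_weierstrassP_eq`; the sign of `y` is adjusted by
`z ↦ −z`). [folklore] -/
theorem exists_psi_eq {p : Fin 3 → ℂ} (hp : p ∈ (curve2 L).points) :
    ∃ z, z ∉ L.lattice ∧ ℘'[L] z ≠ 0 ∧ psi L z = p := by
  rw [mem_points_curve2_iff] at hp
  obtain ⟨hcub, hw⟩ := hp
  have hp1 : p 1 ≠ 0 := fun h => by simp [h] at hw
  obtain ⟨z, hz, hx⟩ := L.exists_weierstrassP_eq (p 0)
  have hsq : (℘'[L] z / 2) ^ 2 = p 1 ^ 2 := by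
    rw [hcub, ← hx]
    have h := L.derivWeierstrassP_sq z hz
    simp only [A, B]
    linear_combination (1 / 4 : ℂ) * h
  have hw' : p 2 = (p 1)⁻¹ := eq_inv_of_mul_eq_one_left hw
  rcases sq_eq_sq_iff_eq_or_eq_neg.1 hsq with h | h
  · refine ⟨z, hz, fun h0 => hp1 (by rw [← h, h0, zero_div]), ?_⟩
    funext k
    fin_cases k
    · simpa using hx
    · simpa using h
    · simp [hw', h]
  · have hz' : -z ∉ L.lattice := fun h' => hz (by simpa using neg_mem h')
    refine ⟨-z, hz', fun h0 => hp1 ?_, ?_⟩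
    · rw [L.derivWeierstrassP_neg, neg_eq_zero] at h0
      have : p 1 = -(℘'[L] z / 2) := by rw [h, neg_neg]
      rw [this, h0, zero_div, neg_zero]
    · funext k
      fin_cases k
      · simpa [L.weierstrassP_neg] using hx
      · simp [L.derivWeierstrassP_neg, neg_div, h]
      · simp [L.derivWeierstrassP_neg, neg_div, h, hw']

/-- On `Z₂`, `℘′ ≠ 0` means `2z ∉ Λ`. [folklore] -/
theorem two_mul_notMem {z : ℂ} (h2 : ℘'[L] z ≠ 0) : 2 * z ∉ L.lattice :=
  PeriodPair.two_mul_notMem_lattice_of_derivWeierstrassP_ne_zero h2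

/-! ### Small real shifts stay in the domain of `ψ` -/

/-- For `z₀ ∉ Λ`, `z₀ + t ∉ Λ` for small real `t`. [folklore] -/
theorem eventually_shift_notMem {z₀ : ℂ} (hz₀ : z₀ ∉ L.lattice) :
    ∀ᶠ t : ℝ in 𝓝 0, z₀ + (t : ℂ) ∉ L.lattice := by
  have hshift : Continuous fun t : ℝ => z₀ + (t : ℂ) := by fun_prop
  have : (fun t : ℝ => z₀ + (t : ℂ)) ⁻¹' (L.lattice : Set ℂ)ᶜ ∈ 𝓝 (0 : ℝ) :=
    hshift.continuousAt.preimage_mem_nhds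
      (L.isClosed_lattice.isOpen_compl.mem_nhds (by simpa using hz₀))
  filter_upwards [this] with t ht using ht

/-- For `z₀ ∉ Λ` with `℘′(z₀) ≠ 0`, `℘′(z₀ + t) ≠ 0` for small real `t`. [folklore] -/
theorem eventually_shift_deriv_ne {z₀ : ℂ} (hz₀ : z₀ ∉ L.lattice) (h2 : ℘'[L] z₀ ≠ 0) :
    ∀ᶠ t : ℝ in 𝓝 0, ℘'[L] (z₀ + (t : ℂ)) ≠ 0 := by
  have hshift : Continuous fun t : ℝ => z₀ + (t : ℂ) := by fun_prop
  have hc : ContinuousAt (fun t : ℝ => ℘'[L] (z₀ + (t : ℂ))) 0 := by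
    have hd : ContinuousAt ℘'[L] z₀ :=
      (L.differentiableOn_derivWeierstrassP.differentiableAt
        (L.isClosed_lattice.isOpen_compl.mem_nhds hz₀)).continuousAt
    exact hd.comp_of_eq hshift.continuousAt (by simp)
  exact hc.eventually_ne (by simpa using h2)

/-! ### `Z₂` is a smooth affine curve over `ℚ̄` -/

/-- `f ∈ ℚ̄[x, y, w]`. [folklore] -/
theorem hasAlgCoeffs_fPoly3 (h₂ : IsAlgebraic ℚ L.g₂) (h₃ : IsAlgebraic ℚ L.g₃) :
    HasAlgCoeffs (fPoly3 L) :=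
  (((hasAlgCoeffs_X (n := 3) 0).pow 3).add
    ((hasAlgCoeffs_C (isAlgebraic_A L h₂)).mul (hasAlgCoeffs_X 0))).add
    (hasAlgCoeffs_C (isAlgebraic_B L h₃))

/-- **`Z₂` is a smooth affine curve over `ℚ̄`** (for `g₂, g₃ ∈ ℚ̄`): the two gradients
`(−f′, 2y, 0)`, `(0, w, y)` are independent at every point (`y ≠ 0` on `Z₂`), and no point is
isolated (`ψ(z₀ + t) → ψ(z₀)` with `℘(z₀ + t) ≠ ℘(z₀)` for small `t ≠ 0`, as `℘′(z₀) ≠ 0`).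
[folklore] -/
theorem smooth2 (h₂ : IsAlgebraic ℚ L.g₂) (h₃ : IsAlgebraic ℚ L.g₃) :
    (curve2 L).IsSmoothAffineCurve where
  algebraic j := by
    fin_cases j
    · simpa using ((hasAlgCoeffs_X (n := 3) 1).pow 2).sub (hasAlgCoeffs_fPoly3 L h₂ h₃)
    · simpa using ((hasAlgCoeffs_X (n := 3) 2).mul (hasAlgCoeffs_X 1)).sub hasAlgCoeffs_one
  rank_eq p hp := by
    have hp1 : p 1 ≠ 0 := fun h => by
      rw [mem_points_curve2_iff] at hp
      simp [h] at hp
    have hfun : (fun j => (curve2 L).gradient j p) =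
        ![![-(3 * p 0 ^ 2 + A L), 2 * p 1, 0], ![0, p 2, p 1]] := by
      funext j
      fin_cases j
      · simpa using gradient_curve2_zero L p
      · simpa using gradient_curve2_one L p
    have hli : LinearIndependent ℂ ![![-(3 * p 0 ^ 2 + A L), 2 * p 1, 0], ![0, p 2, p 1]] := by
      rw [LinearIndependent.pair_iff]
      intro s t hst
      have h2 := congrFun hst 2
      have h1 := congrFun hst 1
      simp only [Pi.add_apply, Pi.smul_apply, Matrix.cons_val_zero, Matrix.cons_val_one,
        Matrix.head_cons, smul_eq_mul, mul_zero, zero_add, Pi.zero_apply,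
        Matrix.cons_val_two, Matrix.tail_cons] at h1 h2
      have ht : t = 0 := (mul_eq_zero.mp h2).resolve_right hp1
      rw [ht, zero_mul, add_zero] at h1
      have hs : s = 0 := by
        rcases mul_eq_zero.mp h1 with h | h
        · exact h
        · exact absurd ((mul_eq_zero.mp h).resolve_left two_ne_zero) hp1
      exact ⟨hs, ht⟩
    rw [hfun, finrank_span_eq_card hli]
    rfl
  not_isolated p hp := by
    obtain ⟨z₀, hz₀, h2, rfl⟩ := exists_psi_eq L hp
    -- the curve `t ↦ ψ(z₀ + t)` for real `t`
    have hev1 := eventually_shift_notMem L hz₀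
    have hev2 := eventually_shift_deriv_ne L hz₀ h2
    have hev3 : ∀ᶠ t : ℝ in 𝓝[≠] 0, ℘[L] (z₀ + (t : ℂ)) ≠ ℘[L] z₀ := by
      have hd : HasDerivAt (fun t : ℝ => ℘[L] (z₀ + (t : ℂ))) (℘'[L] z₀) 0 := by
        have h := hasDerivAt_psi_shift L z₀ (t := 0) (by simpa using hz₀) (by simpa using h2) 0
        simpa using h
      exact hd.eventually_ne h2
    have hcont : Tendsto (fun t : ℝ => psi L (z₀ + (t : ℂ))) (𝓝 0) (𝓝 (psi L z₀)) := by
      rw [tendsto_pi_nhds]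
      intro k
      have h := (hasDerivAt_psi_shift L z₀ (t := 0) (by simpa using hz₀) (by simpa using h2)
        k).continuousAt.tendsto
      simpa using h
    refine mem_closure_of_tendsto (b := 𝓝[≠] (0 : ℝ)) (f := fun t : ℝ => psi L (z₀ + (t : ℂ)))
      (hcont.mono_left nhdsWithin_le_nhds) ?_
    filter_upwards [mem_nhdsWithin_of_mem_nhds hev1, mem_nhdsWithin_of_mem_nhds hev2, hev3]
      with t ht1 ht2 ht3
    refine ⟨psi_mem_points L ht1 ht2, fun h => ht3 ?_⟩
    have h0 := congrFun h 0
    simpa using h0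

/-! ### The tangent line of `Z₂` at `ψ(z)` is spanned by `ψ′(z)` -/

/-- At `ψ(z)` every tangent vector of `Z₂` is a multiple of `ψ′(z)` (the tangent space of a
smooth affine curve is a line, `tangent_parallel`; `ψ′(z)₀ = ℘′(z) ≠ 0`). [folklore] -/
theorem tangent_eq_smul_psiD (hE2 : (curve2 L).IsSmoothAffineCurve) {z : ℂ} (hz : z ∉ L.lattice)
    (h2 : ℘'[L] z ≠ 0) {v : Fin 3 → ℂ} (hv : v ∈ (curve2 L).tangentSpace (psi L z)) :
    v = (v 0 / ℘'[L] z) • psiD L z := by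
  funext j
  have h := tangent_parallel hE2 (psi_mem_points L hz h2) hv (psiD_mem_tangentSpace L h2) 0 j
  simp only [psiD_apply_zero] at h
  simp only [Pi.smul_apply, smul_eq_mul]
  field_simp
  linear_combination h

/-- **A form vanishes on `Z₂` as soon as it kills `ψ′(z)` at every `ψ(z)`.** [folklore] -/
theorem vanishesOn_curve2_of_psi (hE2 : (curve2 L).IsSmoothAffineCurve)
    (ν : Fin 3 → MvPolynomial (Fin 3) ℂ)
    (h : ∀ z, z ∉ L.lattice → ℘'[L] z ≠ 0 → ∑ i, eval (psi L z) (ν i) * psiD L z i = 0) :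
    VanishesOn (curve2 L) ν := by
  intro p hp v hv
  obtain ⟨z, hz, h2, rfl⟩ := exists_psi_eq L hp
  rw [tangent_eq_smul_psiD L hE2 hz h2 hv]
  simp only [Pi.smul_apply, smul_eq_mul]
  have e : ∑ i, eval (psi L z) (ν i) * (v 0 / ℘'[L] z * psiD L z i) =
      v 0 / ℘'[L] z * ∑ i, eval (psi L z) (ν i) * psiD L z i := by
    rw [Finset.mul_sum]
    refine Finset.sum_congr rfl fun i _ => ?_
    ring
  rw [e, h z hz h2, mul_zero]

/-! ### The maps `ι = (x, y)` and `dbl = [2]` as polynomial maps `Z₂ → E_L` -/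

/-- The projection `ι = (x, y) : Z₂ → E_L`. [folklore] -/
def iota : Fin 2 → MvPolynomial (Fin 3) ℂ := ![X 0, X 1]

/-- The tangent slope `m = (3x² + A) w / 2` (`= (3x² + A)/(2y)` on `Z₂`). [folklore] -/
def slope : MvPolynomial (Fin 3) ℂ := C (1 / 2 : ℂ) * ((C 3 * X 0 ^ 2 + C (A L)) * X 2)

/-- `x(2P) = m² − 2x`. [cite: SilvermanAEC2009, III.2.3 (d)] -/
def dblX : MvPolynomial (Fin 3) ℂ := slope L ^ 2 - C 2 * X 0

/-- `y(2P) = m (x − x(2P)) − y`. [cite: SilvermanAEC2009, III.2.3 (d)] -/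
def dblY : MvPolynomial (Fin 3) ℂ := slope L * (X 0 - dblX L) - X 1

/-- **The doubling map** `dbl = (x(2P), y(2P)) : Z₂ → E_L`. [cite: SilvermanAEC2009, III.2.3 (d)] -/
def dbl : Fin 2 → MvPolynomial (Fin 3) ℂ := ![dblX L, dblY L]

/-- `R = −2m = −(3x² + A) w`, the exact part of `dbl^*(x dx/y) − 2 x dx/y` (from
`ζ(2z) = 2ζ(z) + m(ψ(z))`). [folklore] -/
def rPoly : MvPolynomial (Fin 3) ℂ := C (-2 : ℂ) * slope L

/-- `ι` is over `ℚ̄`. [folklore] -/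
theorem hasAlgCoeffs_iota : ∀ j, HasAlgCoeffs (iota j) := by
  intro j
  fin_cases j
  · simpa [iota] using hasAlgCoeffs_X (n := 3) 0
  · simpa [iota] using hasAlgCoeffs_X (n := 3) 1

section Alg

variable (h₂ : IsAlgebraic ℚ L.g₂)
include h₂

/-- `m` is over `ℚ̄`. [folklore] -/
theorem hasAlgCoeffs_slope : HasAlgCoeffs (slope L) :=
  (hasAlgCoeffs_C (by rw [one_div]; exact (isAlgebraic_nat 2).inv)).mul
    ((((hasAlgCoeffs_C (isAlgebraic_nat 3)).mul ((hasAlgCoeffs_X 0).pow 2)).add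
      (hasAlgCoeffs_C (isAlgebraic_A L h₂))).mul (hasAlgCoeffs_X 2))

/-- `x(2P)` is over `ℚ̄`. [folklore] -/
theorem hasAlgCoeffs_dblX : HasAlgCoeffs (dblX L) :=
  ((hasAlgCoeffs_slope L h₂).pow 2).sub ((hasAlgCoeffs_C (isAlgebraic_nat 2)).mul (hasAlgCoeffs_X 0))

/-- `y(2P)` is over `ℚ̄`. [folklore] -/
theorem hasAlgCoeffs_dblY : HasAlgCoeffs (dblY L) :=
  ((hasAlgCoeffs_slope L h₂).mul ((hasAlgCoeffs_X 0).sub (hasAlgCoeffs_dblX L h₂))).sub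
    (hasAlgCoeffs_X 1)

/-- `dbl` is over `ℚ̄`. [folklore] -/
theorem hasAlgCoeffs_dbl : ∀ j, HasAlgCoeffs (dbl L j) := by
  intro j
  fin_cases j
  · simpa [dbl] using hasAlgCoeffs_dblX L h₂
  · simpa [dbl] using hasAlgCoeffs_dblY L h₂

/-- `R` is over `ℚ̄`. [folklore] -/
theorem hasAlgCoeffs_rPoly : HasAlgCoeffs (rPoly L) :=
  (hasAlgCoeffs_C (isAlgebraic_int 2).neg).mul (hasAlgCoeffs_slope L h₂)

end Alg

/-- `ι(p) = (p₀, p₁)`. [folklore] -/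
theorem iota_eval (p : Fin 3 → ℂ) : (fun j => eval p (iota j)) = ![p 0, p 1] := by
  funext j
  fin_cases j <;> simp [iota]

/-- `ι(ψ(z)) = φ(z)`. [folklore] -/
theorem iota_psi (z : ℂ) : (fun j => eval (psi L z) (iota j)) = phi L z := by
  rw [iota_eval]
  rfl

/-- `m(ψ(z)) = ℘″(z)/(2℘′(z))` (`℘″ = 6℘² − g₂/2`). [folklore] -/
theorem eval_slope_psi {z : ℂ} (hz : z ∉ L.lattice) (h2 : ℘'[L] z ≠ 0) :
    eval (psi L z) (slope L) = deriv ℘'[L] z / ℘'[L] z / 2 := by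
  rw [L.deriv_derivWeierstrassP hz]
  simp only [slope, map_mul, eval_C, map_add, map_pow, eval_X, psi_apply_zero, psi_apply_two, A]
  field_simp
  ring

/-- **`x(2P)` along `ψ` is `℘(2z)`** (duplication formula for `℘`,
`PeriodPair.weierstrassP_two_mul_holds`). [cite: ArmitageEberlein2001, §7.4.2 Cor. 7.1] -/
theorem eval_dblX_psi {z : ℂ} (hz : z ∉ L.lattice) (h2 : ℘'[L] z ≠ 0) :
    eval (psi L z) (dblX L) = ℘[L] (2 * z) := by
  rw [L.weierstrassP_two_mul_holds z hz h2]
  simp only [dblX, map_sub, map_pow, map_mul, eval_C, eval_X, eval_slope_psi L hz h2,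
    psi_apply_zero]
  ring

/-- **`y(2P)` along `ψ` is `℘′(2z)/2`** (duplication formula for `℘′`,
`PeriodPair.derivWeierstrassP_two_mul_of_notMem`). [cite: SilvermanAEC2009, III.2.3 (d)] -/
theorem eval_dblY_psi {z : ℂ} (hz : z ∉ L.lattice) (h2 : ℘'[L] z ≠ 0) :
    eval (psi L z) (dblY L) = ℘'[L] (2 * z) / 2 := by
  rw [PeriodPair.derivWeierstrassP_two_mul_of_notMem hz (two_mul_notMem L h2)]
  simp only [dblY, map_sub, map_mul, eval_X, eval_dblX_psi L hz h2, eval_slope_psi L hz h2,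
    psi_apply_zero, psi_apply_one]
  ring

/-- **`dbl(ψ(z)) = φ(2z)`**. [cite: SilvermanAEC2009, III.2.3 (d)] -/
theorem dbl_psi {z : ℂ} (hz : z ∉ L.lattice) (h2 : ℘'[L] z ≠ 0) :
    (fun j => eval (psi L z) (dbl L j)) = phi L (2 * z) := by
  funext j
  fin_cases j
  · simpa [dbl] using eval_dblX_psi L hz h2
  · simpa [dbl] using eval_dblY_psi L hz h2

/-- `ι` maps `Z₂` into `E_L`. [folklore] -/
theorem iota_mapsTo : ∀ p ∈ (curve2 L).points, (fun j => eval p (iota j)) ∈ (curve L).points := by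
  intro p hp
  rw [iota_eval, Weier.mem_points_iff, Weier.eval_fPoly]
  rw [mem_points_curve2_iff] at hp
  simpa using hp.1

/-- `dbl` maps `Z₂` into `E_L` (`φ(2z) ∈ E_L`). [folklore] -/
theorem dbl_mapsTo : ∀ p ∈ (curve2 L).points, (fun j => eval p (dbl L j)) ∈ (curve L).points := by
  intro p hp
  obtain ⟨z, hz, h2, rfl⟩ := exists_psi_eq L hp
  rw [dbl_psi L hz h2]
  exact phi_mem_points L (two_mul_notMem L h2)

/-! ### Directional derivatives along `ψ` -/

/-- `Dι(ψ(z)) ψ′(z) = φ′(z)`. [folklore] -/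
theorem pair_pderiv_iota (z : ℂ) (j : Fin 2) :
    ∑ i, eval (psi L z) (pderiv i (iota j)) * psiD L z i = phiD L z j := by
  fin_cases j <;> simp [iota, Pi.single_apply]

/-- The derivative of a polynomial along `t ↦ ψ(z + t)` at `t = 0`. [folklore] -/
theorem hasDerivAt_eval_psi_shift {z : ℂ} (hz : z ∉ L.lattice) (h2 : ℘'[L] z ≠ 0)
    (P : MvPolynomial (Fin 3) ℂ) :
    HasDerivAt (fun t : ℝ => eval (psi L (z + t)) P)
      (∑ i, eval (psi L z) (pderiv i P) * psiD L z i) 0 := by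
  have h := hasDerivAt_eval_comp (γ := fun t : ℝ => psi L (z + t)) (γ' := psiD L z) (t := 0)
    (fun i => by
      have h := hasDerivAt_psi_shift L z (t := 0) (by simpa using hz) (by simpa using h2) i
      simpa using h) P
  simpa using h

/-- **`D(dbl)(ψ(z)) ψ′(z) = 2 φ′(2z)`**: the derivative at `t = 0` of
`t ↦ dbl(ψ(z + t)) = φ(2z + 2t)`. [folklore] -/
theorem pair_pderiv_dbl {z : ℂ} (hz : z ∉ L.lattice) (h2 : ℘'[L] z ≠ 0) (j : Fin 2) :
    ∑ i, eval (psi L z) (pderiv i (dbl L j)) * psiD L z i = 2 * phiD L (2 * z) j := by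
  have hD := hasDerivAt_eval_psi_shift L hz h2 (dbl L j)
  have hE : (fun t : ℝ => phi L (2 * z + t * 2) j) =ᶠ[𝓝 0]
      fun t : ℝ => eval (psi L (z + t)) (dbl L j) := by
    filter_upwards [eventually_shift_notMem L hz, eventually_shift_deriv_ne L hz h2]
      with t ht1 ht2
    have h := congrFun (dbl_psi L ht1 ht2) j
    rw [h]
    congr 2
    ring
  have hD2 : HasDerivAt (fun t : ℝ => phi L (2 * z + t * 2) j)
      (phiD L (2 * z + ((0 : ℝ) : ℂ) * 2) j * 2) 0 :=
    hasDerivAt_phi_line L (2 * z) 2 (by simpa using two_mul_notMem L h2) j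
  have h := hD.unique (hD2.congr_of_eventuallyEq hE.symm)
  rw [h]
  simp only [ofReal_zero, zero_mul, add_zero]
  ring

/-- **`DR(ψ(z)) ψ′(z) = 4℘(2z) − 4℘(z)`** (`R = −(3x² + A) w`; duplication formula for `℘`).
[folklore] -/
theorem pair_pderiv_rPoly {z : ℂ} (hz : z ∉ L.lattice) (h2 : ℘'[L] z ≠ 0) :
    ∑ i, eval (psi L z) (pderiv i (rPoly L)) * psiD L z i = 4 * ℘[L] (2 * z) - 4 * ℘[L] z := by
  have hx2 := L.weierstrassP_two_mul_holds z hz h2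
  rw [L.deriv_derivWeierstrassP hz] at hx2
  rw [hx2]
  simp only [rPoly, slope, Fin.sum_univ_three, map_mul, Derivation.leibniz, Derivation.leibniz_pow,
    pderiv_C, pderiv_X, map_add, smul_eq_mul, eval_C, eval_X, map_pow, map_zero,
    psi_apply_zero, psi_apply_two, psiD_apply_zero, psiD_apply_one, psiD_apply_two,
    Pi.single_apply, A]
  simp
  field_simp
  ring

/-! ### The identities of forms on `Z₂` -/

/-- `ν₀ = dbl^*θ₀ − 2 ι^*θ₀`. [folklore] -/
def nu0 : Fin 3 → MvPolynomial (Fin 3) ℂ :=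
  formPullback (dbl L) (theta0 L) - (2 : ℂ) • formPullback iota (theta0 L)

/-- `ν₁ = dbl^*θ₁ − 2 ι^*θ₁ − dR`. [folklore] -/
def nu1 : Fin 3 → MvPolynomial (Fin 3) ℂ :=
  formPullback (dbl L) (theta1 L) - (2 : ℂ) • formPullback iota (theta1 L) - formD (rPoly L)

/-- **`dbl^*θ₀ = 2 ι^*θ₀` on `Z₂`** (`[2]^* dz = 2 dz`): `ν₀` vanishes on `Z₂`.
[cite: HuberWustholz2022, §18.1 (p. 160)] -/
theorem vanishesOn_nu0 (hE2 : (curve2 L).IsSmoothAffineCurve) : VanishesOn (curve2 L) (nu0 L) := by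
  refine vanishesOn_curve2_of_psi L hE2 _ fun z hz h2 => ?_
  have h2z : 2 * z ∉ L.lattice := two_mul_notMem L h2
  have e : ∀ i, eval (psi L z) (nu0 L i) * psiD L z i =
      eval (psi L z) (formPullback (dbl L) (theta0 L) i) * psiD L z i -
        2 * (eval (psi L z) (formPullback iota (theta0 L) i) * psiD L z i) := fun i => by
    simp only [nu0, Pi.sub_apply, Pi.smul_apply, map_sub, smul_eval]
    ring
  rw [Finset.sum_congr rfl fun i _ => e i, Finset.sum_sub_distrib, ← Finset.mul_sum,
    formPullback_pair, formPullback_pair, dbl_psi L hz h2, iota_psi]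
  have hs1 : ∑ j, eval (phi L (2 * z)) (theta0 L j) *
      (∑ i, eval (psi L z) (pderiv i (dbl L j)) * psiD L z i) =
      2 * ∑ j, eval (phi L (2 * z)) (theta0 L j) * phiD L (2 * z) j := by
    rw [Finset.mul_sum]
    refine Finset.sum_congr rfl fun j _ => ?_
    rw [pair_pderiv_dbl L hz h2 j]
    ring
  have hs2 : ∑ j, eval (phi L z) (theta0 L j) *
      (∑ i, eval (psi L z) (pderiv i (iota j)) * psiD L z i) =
      ∑ j, eval (phi L z) (theta0 L j) * phiD L z j :=
    Finset.sum_congr rfl fun j _ => by rw [pair_pderiv_iota L z j]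
  rw [hs1, hs2, theta0_phi L h2z, theta0_phi L hz]
  ring

/-- **`dbl^*θ₁ = 2 ι^*θ₁ + dR` on `Z₂`** (`[2]^*(℘ dz) = 2℘ dz − 2 dm`, i.e.
`ζ(2z) = 2ζ(z) + m`): `ν₁` vanishes on `Z₂`. [cite: HuberWustholz2022, §18.1 (p. 160)] -/
theorem vanishesOn_nu1 (hE2 : (curve2 L).IsSmoothAffineCurve) : VanishesOn (curve2 L) (nu1 L) := by
  refine vanishesOn_curve2_of_psi L hE2 _ fun z hz h2 => ?_
  have h2z : 2 * z ∉ L.lattice := two_mul_notMem L h2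
  have e : ∀ i, eval (psi L z) (nu1 L i) * psiD L z i =
      eval (psi L z) (formPullback (dbl L) (theta1 L) i) * psiD L z i -
        2 * (eval (psi L z) (formPullback iota (theta1 L) i) * psiD L z i) -
        eval (psi L z) (pderiv i (rPoly L)) * psiD L z i := fun i => by
    simp only [nu1, formD, Pi.sub_apply, Pi.smul_apply, map_sub, smul_eval]
    ring
  rw [Finset.sum_congr rfl fun i _ => e i, Finset.sum_sub_distrib, Finset.sum_sub_distrib,
    ← Finset.mul_sum, formPullback_pair, formPullback_pair, dbl_psi L hz h2, iota_psi,
    pair_pderiv_rPoly L hz h2]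
  have hs1 : ∑ j, eval (phi L (2 * z)) (theta1 L j) *
      (∑ i, eval (psi L z) (pderiv i (dbl L j)) * psiD L z i) =
      2 * ∑ j, eval (phi L (2 * z)) (theta1 L j) * phiD L (2 * z) j := by
    rw [Finset.mul_sum]
    refine Finset.sum_congr rfl fun j _ => ?_
    rw [pair_pderiv_dbl L hz h2 j]
    ring
  have hs2 : ∑ j, eval (phi L z) (theta1 L j) *
      (∑ i, eval (psi L z) (pderiv i (iota j)) * psiD L z i) =
      ∑ j, eval (phi L z) (theta1 L j) * phiD L z j :=
    Finset.sum_congr rfl fun j _ => by rw [pair_pderiv_iota L z j]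
  rw [hs1, hs2, theta1_phi L h2z, theta1_phi L hz]
  ring


/-! ### The lifted segment `ψ∘[a, b]` on `Z₂` -/

/-- If `2·[a, b]` avoids `Λ` then `℘′ ≠ 0` along `[a, b]`. [folklore] -/
theorem seg_deriv_ne {a b : ℂ} (hab : ∀ t ∈ Icc (0 : ℝ) 1, a + t * (b - a) ∉ L.lattice)
    (hab2 : ∀ t ∈ Icc (0 : ℝ) 1, 2 * (a + t * (b - a)) ∉ L.lattice) :
    ∀ t ∈ Icc (0 : ℝ) 1, ℘'[L] (a + t * (b - a)) ≠ 0 := fun t ht =>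
  L.derivWeierstrassP_ne_zero (hab t ht) (hab2 t ht)

/-- If `2·[a, b]` avoids `Λ` then the segment `[2a, 2b]` avoids `Λ`. [folklore] -/
theorem seg_double_notMem {a b : ℂ} (hab2 : ∀ t ∈ Icc (0 : ℝ) 1, 2 * (a + t * (b - a)) ∉ L.lattice) :
    ∀ t ∈ Icc (0 : ℝ) 1, 2 * a + t * (2 * b - 2 * a) ∉ L.lattice := fun t ht => by
  have h := hab2 t ht
  have e : 2 * (a + (t : ℂ) * (b - a)) = 2 * a + (t : ℂ) * (2 * b - 2 * a) := by ring
  rwa [e] at h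

/-- The coordinates of `ψ(a)` are algebraic at an algebraic point `a`. [folklore] -/
theorem IsAlgPt.psi {a : ℂ} (ha : IsAlgPt L a) : ∀ k, IsAlgebraic ℚ (psi L a k) := by
  intro k
  fin_cases k
  · simpa using ha.2 0
  · simpa using ha.2 1
  · simpa using (ha.2 1).inv

/-- **`2a` is an algebraic point if `a` is** (and `2a ∉ Λ`): `φ(2a) = dbl(ψ(a))` with `dbl` over
`ℚ̄`. [folklore] -/
theorem IsAlgPt.two_mul (h₂ : IsAlgebraic ℚ L.g₂) {a : ℂ} (ha : IsAlgPt L a)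
    (h2a : 2 * a ∉ L.lattice) : IsAlgPt L (2 * a) := by
  have h2 : ℘'[L] a ≠ 0 := L.derivWeierstrassP_ne_zero ha.1 h2a
  refine ⟨h2a, fun k => ?_⟩
  rw [← congrFun (dbl_psi L ha.1 h2) k]
  exact (hasAlgCoeffs_dbl L h₂ k).isAlgebraic_eval (IsAlgPt.psi L ha)

/-- `R(ψ(a)) ∈ ℚ̄` at an algebraic point. [folklore] -/
theorem isAlgebraic_eval_rPoly (h₂ : IsAlgebraic ℚ L.g₂) {a : ℂ} (ha : IsAlgPt L a) :
    IsAlgebraic ℚ (eval (psi L a) (rPoly L)) :=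
  (hasAlgCoeffs_rPoly L h₂).isAlgebraic_eval (IsAlgPt.psi L ha)

variable {L} in
/-- **The lifted segment path `ψ∘[a, b]` on `Z₂`**, for a closed segment `[a, b]` with `2·[a,b]`
avoiding `Λ` and algebraic end points. [folklore] -/
def liftPath2 {a b : ℂ} (hab : ∀ t ∈ Icc (0 : ℝ) 1, a + t * (b - a) ∉ L.lattice)
    (hab2 : ∀ t ∈ Icc (0 : ℝ) 1, 2 * (a + t * (b - a)) ∉ L.lattice)
    (ha : IsAlgPt L a) (hb : IsAlgPt L b) : CurvePath (curve2 L) where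
  toFun t := psi L (a + t * (b - a))
  contDiffOn := by
    have hseg := contDiffOn_segFun L hab
    have h0 := contDiffOn_pi.1 hseg 0
    have h1 := contDiffOn_pi.1 hseg 1
    simp only [segFun_apply, phi_apply_zero, phi_apply_one] at h0 h1
    refine contDiffOn_pi.2 fun k => ?_
    fin_cases k
    · exact h0
    · exact h1
    · exact h1.inv fun t ht => div_ne_zero (seg_deriv_ne L hab hab2 t ht) two_ne_zero
  mem_points t ht := psi_mem_points L (hab t ht) (seg_deriv_ne L hab hab2 t ht)
  algebraic_zero k := by simpa using IsAlgPt.psi L ha k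
  algebraic_one k := by simpa using IsAlgPt.psi L hb k

/-- The parametrisation of `liftPath2`. [folklore] -/
@[simp] theorem liftPath2_toFun {a b : ℂ} (hab : ∀ t ∈ Icc (0 : ℝ) 1, a + t * (b - a) ∉ L.lattice)
    (hab2 : ∀ t ∈ Icc (0 : ℝ) 1, 2 * (a + t * (b - a)) ∉ L.lattice)
    (ha : IsAlgPt L a) (hb : IsAlgPt L b) (t : ℝ) :
    (liftPath2 hab hab2 ha hb).toFun t = psi L (a + t * (b - a)) := rfl

/-! ### The doubling descent -/

/-- `2 ∈ ℚ̄`. [folklore] -/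
theorem isAlgebraic_two : IsAlgebraic ℚ (2 : ℂ) := by
  exact_mod_cast isAlgebraic_nat (R := ℚ) (A := ℂ) 2

section Descent

variable (h₂ : IsAlgebraic ℚ L.g₂) (h₃ : IsAlgebraic ℚ L.g₃)
include h₂ h₃

/-- **Doubling descent for `θ₀ = dx/y`**: if `2·[a, b]` avoids `Λ` (algebraic end points), then
`(E_L, θ₀, φ∘[2a, 2b]) − 2·(E_L, θ₀, φ∘[a, b])` lies in the span of the elementary relations
(functoriality (R4) along `[2] : Z₂ → E_L` and along `ι : Z₂ → E_L`, with `[2]^*θ₀ = 2 ι^*θ₀` in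
`Ω¹(Z₂)`). [cite: HuberWustholz2022, §13.1 (B) (p. 120), §18.1 (p. 160)] -/
theorem span_descent_theta0 {a b : ℂ} (hab : ∀ t ∈ Icc (0 : ℝ) 1, a + t * (b - a) ∉ L.lattice)
    (hab2 : ∀ t ∈ Icc (0 : ℝ) 1, 2 * (a + t * (b - a)) ∉ L.lattice)
    (ha : IsAlgPt L a) (hb : IsAlgPt L b)
    (h2ab : ∀ t ∈ Icc (0 : ℝ) 1, 2 * a + t * (2 * b - 2 * a) ∉ L.lattice)
    (ha2 : IsAlgPt L (2 * a)) (hb2 : IsAlgPt L (2 * b)) :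
    InSpan (Finsupp.single (⟨curve L, smooth L h₂ h₃, theta0 L, hasAlgCoeffs_theta0 L h₂ h₃,
        segPath h2ab ha2 hb2⟩ : PeriodSymbol) (1 : ℂ) -
      (2 : ℂ) • Finsupp.single (⟨curve L, smooth L h₂ h₃, theta0 L, hasAlgCoeffs_theta0 L h₂ h₃,
        segPath hab ha hb⟩ : PeriodSymbol) 1) := by
  have hE := smooth L h₂ h₃
  have hE2 := smooth2 L h₂ h₃
  have hθ := hasAlgCoeffs_theta0 L h₂ h₃
  have hιθ : ∀ i, HasAlgCoeffs (formPullback iota (theta0 L) i) :=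
    HasAlgCoeffs.formPullback hasAlgCoeffs_iota hθ
  have hdθ : ∀ i, HasAlgCoeffs (formPullback (dbl L) (theta0 L) i) :=
    HasAlgCoeffs.formPullback (hasAlgCoeffs_dbl L h₂) hθ
  have h2ιθ : ∀ i, HasAlgCoeffs (((2 : ℂ) • formPullback iota (theta0 L)) i) := fun i =>
    (hιθ i).smul isAlgebraic_two
  have hν : ∀ i, HasAlgCoeffs (nu0 L i) := fun i => (hdθ i).sub (h2ιθ i)
  -- the five relations
  have rι := IsElementaryRelation.pushforward (curve2 L) (curve L) hE2 hE iota hasAlgCoeffs_iota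
    (iota_mapsTo L) (theta0 L) hθ (formPullback iota (theta0 L)) hιθ rfl
    (liftPath2 hab hab2 ha hb) (segPath hab ha hb) (fun t _ => by
      rw [iota_eval, segPath_toFun, liftPath2_toFun]
      rfl)
  have rd := IsElementaryRelation.pushforward (curve2 L) (curve L) hE2 hE (dbl L)
    (hasAlgCoeffs_dbl L h₂) (dbl_mapsTo L) (theta0 L) hθ (formPullback (dbl L) (theta0 L)) hdθ rfl
    (liftPath2 hab hab2 ha hb) (segPath h2ab ha2 hb2) (fun t ht => by
      rw [liftPath2_toFun, dbl_psi L (hab t ht) (seg_deriv_ne L hab hab2 t ht), segPath_toFun]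
      congr 1
      ring)
  have radd := IsElementaryRelation.add (curve2 L) hE2 (liftPath2 hab hab2 ha hb)
    (formPullback (dbl L) (theta0 L)) ((2 : ℂ) • formPullback iota (theta0 L)) (nu0 L) hdθ h2ιθ hν
    (by rw [nu0, add_sub_cancel])
  have rvan := IsElementaryRelation.vanish (curve2 L) hE2 (liftPath2 hab hab2 ha hb) (nu0 L) hν
    (vanishesOn_nu0 L hE2)
  have rsmul := IsElementaryRelation.smul (curve2 L) hE2 (liftPath2 hab hab2 ha hb) (2 : ℂ)
    isAlgebraic_two (formPullback iota (theta0 L)) ((2 : ℂ) • formPullback iota (theta0 L)) hιθ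
    h2ιθ rfl
  obtain ⟨k, ρ, cf, hρ, hcf, hsum⟩ := span_add (span_add (span_add (span_sub (span_of_rel radd)
    (span_of_rel rd)) (span_of_rel rsmul)) (span_of_rel rvan))
    (span_smul isAlgebraic_two (span_of_rel rι))
  refine ⟨k, ρ, cf, hρ, hcf, ?_⟩
  rw [← hsum]
  simp only [smul_sub]
  abel

/-- **Doubling descent for `θ₁ = x dx/y`**: if `2·[a, b]` avoids `Λ` (algebraic end points),
then `(E_L, θ₁, φ∘[2a, 2b]) − 2·(E_L, θ₁, φ∘[a, b]) − (R(ψ(b)) − R(ψ(a)))·𝟙`,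
`R = −(3x² + A) w` (so `R(ψ(z)) = −℘″(z)/℘′(z)`), lies in the span of the elementary relations
((R4) along `[2]` and `ι`, `[2]^*θ₁ = 2 ι^*θ₁ + dR` in `Ω¹(Z₂)`, and (R3) for `dR`).
[cite: HuberWustholz2022, §13.1 (B) (p. 120), §18.1 (p. 160)] -/
theorem span_descent_theta1 {a b : ℂ} (hab : ∀ t ∈ Icc (0 : ℝ) 1, a + t * (b - a) ∉ L.lattice)
    (hab2 : ∀ t ∈ Icc (0 : ℝ) 1, 2 * (a + t * (b - a)) ∉ L.lattice)
    (ha : IsAlgPt L a) (hb : IsAlgPt L b)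
    (h2ab : ∀ t ∈ Icc (0 : ℝ) 1, 2 * a + t * (2 * b - 2 * a) ∉ L.lattice)
    (ha2 : IsAlgPt L (2 * a)) (hb2 : IsAlgPt L (2 * b)) :
    InSpan (Finsupp.single (⟨curve L, smooth L h₂ h₃, theta1 L, hasAlgCoeffs_theta1 L h₂ h₃,
        segPath h2ab ha2 hb2⟩ : PeriodSymbol) (1 : ℂ) -
      (2 : ℂ) • Finsupp.single (⟨curve L, smooth L h₂ h₃, theta1 L, hasAlgCoeffs_theta1 L h₂ h₃,
        segPath hab ha hb⟩ : PeriodSymbol) 1 -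
      (eval (psi L b) (rPoly L) - eval (psi L a) (rPoly L)) •
        Finsupp.single PeriodSymbol.unit (1 : ℂ)) := by
  have hE := smooth L h₂ h₃
  have hE2 := smooth2 L h₂ h₃
  have hθ := hasAlgCoeffs_theta1 L h₂ h₃
  have hR := hasAlgCoeffs_rPoly L h₂
  have hιθ : ∀ i, HasAlgCoeffs (formPullback iota (theta1 L) i) :=
    HasAlgCoeffs.formPullback hasAlgCoeffs_iota hθ
  have hdθ : ∀ i, HasAlgCoeffs (formPullback (dbl L) (theta1 L) i) :=
    HasAlgCoeffs.formPullback (hasAlgCoeffs_dbl L h₂) hθ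
  have h2ιθ : ∀ i, HasAlgCoeffs (((2 : ℂ) • formPullback iota (theta1 L)) i) := fun i =>
    (hιθ i).smul isAlgebraic_two
  have hdR : ∀ i, HasAlgCoeffs (formD (rPoly L) i) := hR.formD
  have h2ιθR : ∀ i, HasAlgCoeffs (((2 : ℂ) • formPullback iota (theta1 L) + formD (rPoly L)) i) :=
    fun i => (h2ιθ i).add (hdR i)
  have hν : ∀ i, HasAlgCoeffs (nu1 L i) := fun i => ((hdθ i).sub (h2ιθ i)).sub (hdR i)
  have rι := IsElementaryRelation.pushforward (curve2 L) (curve L) hE2 hE iota hasAlgCoeffs_iota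
    (iota_mapsTo L) (theta1 L) hθ (formPullback iota (theta1 L)) hιθ rfl
    (liftPath2 hab hab2 ha hb) (segPath hab ha hb) (fun t _ => by
      rw [iota_eval, segPath_toFun, liftPath2_toFun]
      rfl)
  have rd := IsElementaryRelation.pushforward (curve2 L) (curve L) hE2 hE (dbl L)
    (hasAlgCoeffs_dbl L h₂) (dbl_mapsTo L) (theta1 L) hθ (formPullback (dbl L) (theta1 L)) hdθ rfl
    (liftPath2 hab hab2 ha hb) (segPath h2ab ha2 hb2) (fun t ht => by
      rw [liftPath2_toFun, dbl_psi L (hab t ht) (seg_deriv_ne L hab hab2 t ht), segPath_toFun]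
      congr 1
      ring)
  have radd1 := IsElementaryRelation.add (curve2 L) hE2 (liftPath2 hab hab2 ha hb)
    (formPullback (dbl L) (theta1 L)) ((2 : ℂ) • formPullback iota (theta1 L) + formD (rPoly L))
    (nu1 L) hdθ h2ιθR hν (by rw [nu1]; abel)
  have radd2 := IsElementaryRelation.add (curve2 L) hE2 (liftPath2 hab hab2 ha hb)
    ((2 : ℂ) • formPullback iota (theta1 L) + formD (rPoly L)) ((2 : ℂ) • formPullback iota (theta1 L))
    (formD (rPoly L)) h2ιθR h2ιθ hdR rfl
  have rvan := IsElementaryRelation.vanish (curve2 L) hE2 (liftPath2 hab hab2 ha hb) (nu1 L) hν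
    (vanishesOn_nu1 L hE2)
  have rsmul := IsElementaryRelation.smul (curve2 L) hE2 (liftPath2 hab hab2 ha hb) (2 : ℂ)
    isAlgebraic_two (formPullback iota (theta1 L)) ((2 : ℂ) • formPullback iota (theta1 L)) hιθ
    h2ιθ rfl
  have rex := IsElementaryRelation.exact (curve2 L) hE2 (liftPath2 hab hab2 ha hb) (rPoly L) hR
    (formD (rPoly L)) hdR rfl
  have e1 : (liftPath2 hab hab2 ha hb).toFun 1 = psi L b := by simp
  have e0 : (liftPath2 hab hab2 ha hb).toFun 0 = psi L a := by simp
  rw [e1, e0] at rex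
  obtain ⟨k, ρ, cf, hρ, hcf, hsum⟩ := span_add (span_add (span_add (span_add (span_add
    (span_sub (span_of_rel radd1) (span_of_rel rd)) (span_of_rel radd2)) (span_of_rel rsmul))
    (span_of_rel rex)) (span_of_rel rvan)) (span_smul isAlgebraic_two (span_of_rel rι))
  refine ⟨k, ρ, cf, hρ, hcf, ?_⟩
  rw [← hsum]
  simp only [smul_sub]
  abel

end Descent

/-- The constant of `span_descent_theta1` is algebraic. [folklore] -/
theorem isAlgebraic_descent_const (h₂ : IsAlgebraic ℚ L.g₂) {a b : ℂ} (ha : IsAlgPt L a)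
    (hb : IsAlgPt L b) : IsAlgebraic ℚ (eval (psi L b) (rPoly L) - eval (psi L a) (rPoly L)) :=
  (isAlgebraic_eval_rPoly L h₂ hb).sub (isAlgebraic_eval_rPoly L h₂ ha)

end Ell

end CurvePeriods

end Literature.NumberTheory.Transcendental

end
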